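/-
Copyright: public-domain mathematics; typed transcription for the H21 Literature library (cell pub-balaban, PAPER SUB-CELL B05 gen 2).

# Bałaban, *Propagators and renormalization transformations for lattice gauge theories. I*,
# Commun. Math. Phys. **95** (1984) 17–40 — Proposition 1.2, step S1: the walk sum (1.131)

[cite: Balaban1984PropagatorsI]  T. Bałaban, Commun. Math. Phys. 95 (1984) 17–40 (= B5 of the series), pp. 36–39.

WHAT THIS MODULE IS.  The proof of Proposition 1.2 of B5 (exponential decay of `G = Δ_a⁻¹`, (1.110)–(1.117)) expands `G`
in a random walk over the lattice of cubes (p. 36, verbatim: "We consider the lattice of cubes of size M₀, M₀ = L^{m₀},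
defined by the lattice T^{(k+m₀)}_{M₀}, and cubes □_z of size 2M₀ and with a center at the point z ∈ T^{(k+m₀)}_{M₀}.
These cubes cover the lattice T_η."), p. 37, verbatim:

  "and we get the desired representation
  (1.123)  `G = C₀(I − R)⁻¹ = Σ_{ω=(ω₀,ω₁,…,ω_n)} h_{ω₀}Gh_{ω₀}K(h_{ω₁})Gh_{ω₁}·…·h_{ω_{n−1}}K(h_{ω_n})Gh_{ω_n}`,
  where the summation is over all finite sequences ω with ω_i ∈ T^{(k+m₀)}_{M₀}.  Of course the sum is convergent only
  if R is small in a proper sense.  This holds if M₀ is sufficiently large."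

Each factor is estimated on p. 38, verbatim: "Defining `2δ₀ = min{⅓δ′₀, M₀⁻¹}`, we obtain
  (1.128)  `|h_{z₁}K(h_{z₂})A| ≤ O(M₀⁻¹) e^{−2δ₀|z₁−z₂|} (|∇A| + |A|)`."
and the estimates are assembled in the display (1.128) ⇒ (1.131), p. 38, verbatim:

  "Gathering together all these estimates we obtain
  `‖ζ∇G∇*J‖_α ≤ O(1)(‖ζ‖_α + |ζ|) Σ_{n=0}^∞ O(1)^{2n} M₀^{−n} Σ_{ω=(ω₀,ω₁,…,ω_n): y∈□_{ω₀}, y′∈□_{ω_n}}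
       e^{−2δ₀|ω₀−ω₁|}·…·e^{−2δ₀|ω_{n−1}−ω_n|} (‖J‖_{α+ε} + |J|)
     ≤ O(1) e^{−δ₀|y−y′|} (‖ζ‖_α + |ζ|)(‖J‖_{α+ε} + |J|) · Σ_{n=0}^∞ O(1)^{2n} M₀^{−n} (Σ_{x∈Z^d} e^{−δ₀M₀|x|})ⁿ.   (1.131)"

followed on p. 39 by: "Let us notice that the constant O(1) under the sum above is an absolute constant depending on d
only, hence we can fix M₀ depending on d only, such that the series is convergent."

No derivation of the SECOND inequality of (1.131) — a purely combinatorial statement about sums over walks of cubes —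
is printed.  Gen 1 of this sub-cell kernel-checked two of its ingredients in `B5` (`chain_split`: the decay extraction
along one walk; `rw_series_bound`: the geometric `n`-series) and certified the rest in prose (GAPS C-B5-11).  THIS FILE
KERNEL-CHECKS THE WHOLE SECOND INEQUALITY OF (1.131) and the uniform bound on the `n`-series, over an abstract finite index
set `S` of cube centres embedded by `ctr : S → X` in a pseudometric space `X` (the unit lattice `T₁^{(k)}` with its torus
distance), with cube membership `y ∈ □_z` typed as `dist y (ctr z) ≤ c`:

* `walkWeight`, `walkSum` — the printed objects: the weight `e^{−κ|ω₀−ω₁|}⋯e^{−κ|ω_{n−1}−ω_n|}` of a walk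
  `ω : Fin (n+1) → S` and the inner sum of (1.131) over the walks with `y ∈ □_{ω₀}`, `y′ ∈ □_{ω_n}` at rate `κ = 2δ₀`;
* `dist_ends_le`, `walkWeight_split` — triangle inequality along the walk and the decay extraction
  `e^{−2δ₀Σ|ω_i−ω_{i+1}|} ≤ e^{2δ₀c}·e^{−δ₀|y−y′|}·e^{−δ₀Σ|ω_i−ω_{i+1}|}` (uses both end conditions);
* `sum_walkWeight_cons`, `tupleSum_le_pow` — splitting off `ω₀` and iterating the row-sum bound
  `Σ_{z′} e^{−δ₀|z−z′|} ≤ K` (`n` times), by the GENERIC finite chain lemmas `tupleSum`, `openChain_le_pow` of the sibling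
  module `B6RandomWalk` (pv08; nothing specific to paper B6 is used);
* `walkSum_le` — **(1.131), second inequality, termwise in `n`**:
  `Σ_{ω: y∈□_{ω₀}, y′∈□_{ω_n}} e^{−2δ₀|ω₀−ω₁|}⋯ ≤ ν · e^{2δ₀c} · e^{−δ₀|y−y′|} · Kⁿ`, where `ν ≥ #{z : y ∈ □_z}`;
* `walkSeries_le`, `walkSeries_summable` — the `n`-series with ratio `Θ·K < 1` is bounded by
  `ν e^{2δ₀c} e^{−δ₀|y−y′|} (1 − ΘK)⁻¹` uniformly in the truncation, and the infinite series converges with the same bound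
  ("such that the series is convergent");
* `twoDelta0` (= the printed `min{⅓δ′₀, M₀⁻¹}`), `prefactor_le` (`2δ₀ ≤ M₀⁻¹` and `c ≤ c′M₀` give `e^{2δ₀c} ≤ e^{c′}`:
  the printed `O(1)`), `twoDelta0_eq_inv` (for `M₀ ≥ 3/δ′₀` the minimum is `M₀⁻¹`, so `δ₀M₀ = ½` and the lattice sum
  `Σ_{x∈Z^d} e^{−δ₀M₀|x|} = Σ_x e^{−|x|/2}` depends on `d` only), `ratio_lt_one` (the series ratio `O(1)²M₀⁻¹K_d < 1` once
  `M₀ > O(1)²K_d`: "we can fix M₀ depending on d only").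

DICTIONARY (printed ↦ typed).  `T^{(k+m₀)}_{M₀}` (cube centres) ↦ a finite type `S` with `ctr : S → X`;  `|z₁ − z₂|`
(torus distance in the unit scale, `= M₀|z′₁ − z′₂|`) ↦ `dist (ctr z₁) (ctr z₂)`;  `y ∈ □_z` ↦ `dist y (ctr z) ≤ c` with
`c = O(1)·M₀` the half-diameter of a cube of size `2M₀`;  a walk `ω = (ω₀,…,ω_n)` ↦ `ω : Fin (n+1) → S`;  the printed
`Σ_{x∈Z^d} e^{−δ₀M₀|x|}` ↦ any `K` with `∀ z, Σ_{z′∈S} e^{−δ₀|z−z′|} ≤ K` (on the torus every site `z′` is counted once at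
its torus distance, which is the minimum over its `Z^d`-representatives, so the torus row sum is bounded by the lattice
sum — this unfolding and the count `ν = ν(d)` of cubes containing a point are the two hypotheses left in printed shape in
`walkSum_le`, and are supplied in the `Z^d` model by section `Hypotheses`: `row_sum_le_lattice`, `card_cubes_containing_le`);
`O(1)^{2n}M₀^{−n}` ↦ `Θⁿ` with `Θ ≥ 0`.

* section `Hypotheses` (v2): the two hypotheses of `walkSum_le` in the `Z^d` model — `card_cubes_containing_le`
  (**ν(d) ≤ 3^d**: a point lies in at most `3^d` of the cubes `|y_i − M₀z′_i| ≤ M₀`, `z′ ∈ Z^d`, via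
  `int_mem_three_of_abs_sub_le_one` and `Fintype.card_piFinset`), `sum_le_tsum_of_injective` / `row_sum_le_lattice`
  (a finite row sum whose sites carry injective lattice representatives is bounded by the lattice series
  `Σ'_{x} g x`, printed `Σ_{x∈Z^d} e^{−δ₀M₀|x|}`).

SIBLING SUB-NODE (carver ruling 2026-08-18, SHARPEN T02.2 split into two disjoint sub-nodes): T02.2(a) is the module
`B5Ineq137` (surge node prover pv07-g3: the bookkeeping (1.135)–(1.137), pp. 39–40, discharging the hypothesis `h137` of
`B5FromB4.prop12G0_of_printed_steps`); the present file is T02.2(b) and types nothing of (1.132)–(1.137).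

WHAT THIS FILE DOES NOT CLAIM.  It does not formalise the operators `G`, `K(h_z)`, the Hölder norms or the estimates
(1.125)–(1.130) producing the factors `O(1)`, `O(M₀⁻¹)e^{−2δ₀|z₁−z₂|}` (those are the hypotheses `Kernel126_127Printed` /
the printed-step structure of `B5.prop12_of_printed_steps`, gen 1), nor the value of `Σ_{x∈Z^d} e^{−|x|/2}`.  Value = kernel
check of the combinatorial skeleton of (1.131) exactly as displayed, NOT summit progress.
-/
import Mathlib
import Literature.MathematicalPhysics.QuantumFieldTheory.Balaban1983to89.B6RandomWalk

/-!
# B5Walk131 — Bałaban CMP 95 (1984), Proposition 1.2 step S1: the walk sum (1.131), kernel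

[cite: Balaban1984PropagatorsI]  pp. 36–39.  The second inequality of the display (1.131) p. 38 — summing the weights
`e^{−2δ₀|ω₀−ω₁|}⋯e^{−2δ₀|ω_{n−1}−ω_n|}` over all walks of `M₀`-cubes with `y ∈ □_{ω₀}`, `y′ ∈ □_{ω_n}` gives
`≤ O(1) e^{−δ₀|y−y′|} (Σ_{x∈Z^d} e^{−δ₀M₀|x|})ⁿ` — and the convergence of the `n`-series (p. 39), kernel-checked over an
abstract finite set of cube centres in a pseudometric space (`walkSum_le`, `walkSeries_le`, `walkSeries_summable`), with
the bookkeeping of `2δ₀ = min{⅓δ′₀, M₀⁻¹}` (`twoDelta0`, `prefactor_le`, `twoDelta0_eq_inv`, `ratio_lt_one`) and, in section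
`Hypotheses`, the `Z^d` model of the two remaining hypotheses (`card_cubes_containing_le`: ν(d) ≤ 3^d; `row_sum_le_lattice`).
Sibling sub-node: `B5Ineq137` (pv07-g3, (1.135)–(1.137)).  See the file
header for the verbatim quotations, the dictionary and the disclaimer (typed skeleton, NOT summit progress).
-/

namespace Literature.MathematicalPhysics.QuantumFieldTheory.Balaban1983to89.B5Walk131
open Finset
open Literature.MathematicalPhysics.QuantumFieldTheory.Balaban1983to89.B6RandomWalk
noncomputable section
open Classical

variable {X S : Type} [PseudoMetricSpace X]

/-- The weight of one walk `ω = (ω₀,…,ω_n)` at rate `κ`: `e^{−κ|ω₀−ω₁|}·…·e^{−κ|ω_{n−1}−ω_n|}` (the factors of (1.123)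
estimated by (1.128), p. 38, carry `κ = 2δ₀`; after the decay extraction the rate is `κ = δ₀`). [cite: Balaban1984PropagatorsI, (1.123) p.37, (1.131) p.38] -/
def walkWeight (ctr : S → X) (κ : ℝ) (n : ℕ) (ω : Fin (n + 1) → S) : ℝ :=
  ∏ i : Fin n, Real.exp (-(κ * dist (ctr (ω (Fin.castSucc i))) (ctr (ω (Fin.succ i)))))

/-- The inner sum of (1.131), p. 38, for fixed `n`: `Σ_{ω=(ω₀,ω₁,…,ω_n): y∈□_{ω₀}, y′∈□_{ω_n}} e^{−2δ₀|ω₀−ω₁|}·…·e^{−2δ₀|ω_{n−1}−ω_n|}`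
over ALL walks `ω : Fin (n+1) → S` ("all finite sequences ω with ω_i ∈ T^{(k+m₀)}_{M₀}", p. 37), cube membership typed as
`dist y (ctr ω₀) ≤ c`, `dist (ctr ω_n) y′ ≤ c`. [cite: Balaban1984PropagatorsI, (1.131) p.38] -/
def walkSum [Fintype S] (ctr : S → X) (δ₀ c : ℝ) (n : ℕ) (y y' : X) : ℝ :=
  ∑ ω : Fin (n + 1) → S,
    if dist y (ctr (ω 0)) ≤ c ∧ dist (ctr (ω (Fin.last n))) y' ≤ c then walkWeight ctr (2 * δ₀) n ω else 0

/-- walk weights are nonnegative. [cite: Balaban1984PropagatorsI, (1.131) p.38] -/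
theorem walkWeight_nonneg (ctr : S → X) (κ : ℝ) (n : ℕ) (ω : Fin (n + 1) → S) : 0 ≤ walkWeight ctr κ n ω :=
  Finset.prod_nonneg fun _ _ => (Real.exp_pos _).le

/-- `Π_i e^{−κ d_i} = e^{−κ Σ_i d_i}`. [cite: Balaban1984PropagatorsI, (1.131) p.38] -/
theorem walkWeight_eq_exp_sum (ctr : S → X) (κ : ℝ) (n : ℕ) (ω : Fin (n + 1) → S) :
    walkWeight ctr κ n ω = Real.exp (-(κ * ∑ i : Fin n, dist (ctr (ω (Fin.castSucc i))) (ctr (ω (Fin.succ i))))) := by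
  unfold walkWeight
  rw [← Real.exp_sum, Finset.mul_sum, ← Finset.sum_neg_distrib]

/-- The end-points of a walk are within its length: `|ω₀ − ω_n| ≤ Σ_i |ω_i − ω_{i+1}|` (triangle inequality along the walk). [cite: Balaban1984PropagatorsI, (1.131) p.38] -/
theorem dist_ends_le (ctr : S → X) (n : ℕ) (ω : Fin (n + 1) → S) :
    dist (ctr (ω 0)) (ctr (ω (Fin.last n))) ≤ ∑ i : Fin n, dist (ctr (ω (Fin.castSucc i))) (ctr (ω (Fin.succ i))) := by
  set f : ℕ → X := fun i => if h : i < n + 1 then ctr (ω ⟨i, h⟩) else ctr (ω (Fin.last n)) with hf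
  have h0 : f 0 = ctr (ω 0) := by simp [hf]
  have hn : f n = ctr (ω (Fin.last n)) := by simp [hf, Fin.last]
  have hmain := dist_le_range_sum_dist f n
  rw [h0, hn] at hmain
  refine hmain.trans (le_of_eq ?_)
  rw [← Fin.sum_univ_eq_sum_range (fun i => dist (f i) (f (i + 1))) n]
  refine Finset.sum_congr rfl fun i _ => ?_
  have h1 : f i = ctr (ω (Fin.castSucc i)) := by
    simp only [hf, dif_pos (Nat.lt_succ_of_lt i.isLt)]
    rfl
  have h2 : f (i + 1) = ctr (ω (Fin.succ i)) := by
    simp only [hf, dif_pos (Nat.succ_lt_succ i.isLt)]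
    rfl
  rw [h1, h2]

/-- Decay extraction for one walk (first half of the second inequality of (1.131), p. 38; the walk form of gen 1ʼs
`B5.chain_split`): if `y ∈ □_{ω₀}` and `y′ ∈ □_{ω_n}` then `|y − y′| ≤ 2c + Σ_i|ω_i − ω_{i+1}|`, hence
`e^{−2δ₀Σ|ω_i−ω_{i+1}|} ≤ e^{2δ₀c} · e^{−δ₀|y−y′|} · e^{−δ₀Σ|ω_i−ω_{i+1}|}`. [cite: Balaban1984PropagatorsI, (1.131) p.38] -/
theorem walkWeight_split (ctr : S → X) (δ₀ c : ℝ) (hδ : 0 ≤ δ₀) (n : ℕ) (ω : Fin (n + 1) → S) (y y' : X)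
    (h0 : dist y (ctr (ω 0)) ≤ c) (hn : dist (ctr (ω (Fin.last n))) y' ≤ c) :
    walkWeight ctr (2 * δ₀) n ω ≤
      Real.exp (2 * δ₀ * c) * Real.exp (-(δ₀ * dist y y')) * walkWeight ctr δ₀ n ω := by
  rw [walkWeight_eq_exp_sum, walkWeight_eq_exp_sum, ← Real.exp_add, ← Real.exp_add]
  apply Real.exp_le_exp.mpr
  set L := ∑ i : Fin n, dist (ctr (ω (Fin.castSucc i))) (ctr (ω (Fin.succ i))) with hL
  have hends := dist_ends_le ctr n ω
  have htri : dist y y' ≤ 2 * c + L := by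
    have := dist_triangle4 y (ctr (ω 0)) (ctr (ω (Fin.last n))) y'
    linarith
  have := mul_le_mul_of_nonneg_left htri hδ
  linarith

/-- Splitting off the first point of a walk: `Σ_{ω} F(ω₀)·W_κ(ω) = Σ_{z} F(z)·tupleSum w_κ n z`, `w_κ(a,b) = e^{−κ|a−b|}`
(`tupleSum` of `B6RandomWalk`: the sum over the remaining points `(ω₁,…,ω_n)`). [cite: Balaban1984PropagatorsI, (1.123) p.37] -/
theorem sum_walkWeight_cons [Fintype S] (ctr : S → X) (κ : ℝ) (n : ℕ) (F : S → ℝ) :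
    ∑ ω : Fin (n + 1) → S, F (ω 0) * walkWeight ctr κ n ω =
      ∑ z : S, F z * tupleSum (fun a b => Real.exp (-(κ * dist (ctr a) (ctr b)))) n z := by
  unfold tupleSum walkWeight
  rw [← Fintype.sum_equiv (Fin.consEquiv fun _ : Fin (n + 1) => S)
    (fun p : S × (Fin n → S) => F p.1 *
      ∏ i : Fin n, Real.exp (-(κ * dist (ctr ((Fin.cons p.1 p.2 : Fin (n + 1) → S) (Fin.castSucc i)))
        (ctr ((Fin.cons p.1 p.2 : Fin (n + 1) → S) (Fin.succ i))))))
    (fun ω : Fin (n + 1) → S => F (ω 0) *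
      ∏ i : Fin n, Real.exp (-(κ * dist (ctr (ω (Fin.castSucc i))) (ctr (ω (Fin.succ i))))))
    (fun p => by simp [Fin.consEquiv]),
    Fintype.sum_prod_type]
  refine Finset.sum_congr rfl fun z _ => ?_
  rw [Finset.mul_sum]
  refine Finset.sum_congr rfl fun ys _ => ?_
  congr 1

/-- Iterating the row-sum bound: if `Σ_{z′} e^{−κ|z−z′|} ≤ K` for every `z` then `tupleSum w_κ n z ≤ Kⁿ` (the printed
`(Σ_{x∈Z^d} e^{−δ₀M₀|x|})ⁿ`; from the generic `B6RandomWalk.openChain_le_pow`). [cite: Balaban1984PropagatorsI, (1.131) p.38] -/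
theorem tupleSum_le_pow [Fintype S] (ctr : S → X) (κ K : ℝ) (hrow : ∀ a : S, ∑ b : S, Real.exp (-(κ * dist (ctr a) (ctr b))) ≤ K)
    (n : ℕ) (z : S) : tupleSum (fun a b => Real.exp (-(κ * dist (ctr a) (ctr b)))) n z ≤ K ^ n := by
  cases n with
  | zero => simp
  | succ m =>
      rw [← openChain_eq_tupleSum]
      exact openChain_le_pow _ (fun _ _ => (Real.exp_pos _).le) K hrow m z

/-- **(1.131), inner sum**: `Σ_{ω: y∈□_{ω₀}, y′∈□_{ω_n}} e^{−2δ₀|ω₀−ω₁|}⋯ ≤ ν · e^{2δ₀c} · e^{−δ₀|y−y′|} · Kⁿ`, where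
`ν ≥ #{z : y ∈ □_z}` and `K ≥ Σ_{z′} e^{−δ₀|z−z′|}` (printed: `Σ_{x∈Z^d} e^{−δ₀M₀|x|}`). [cite: Balaban1984PropagatorsI, (1.131) p.38] -/
theorem walkSum_le [Fintype S] (ctr : S → X) (δ₀ c K ν : ℝ) (hδ : 0 ≤ δ₀) (hK : 0 ≤ K)
    (hrow : ∀ a : S, ∑ b : S, Real.exp (-(δ₀ * dist (ctr a) (ctr b))) ≤ K)
    (y y' : X) (hν : ((Finset.univ.filter fun z : S => dist y (ctr z) ≤ c).card : ℝ) ≤ ν) (n : ℕ) :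
    walkSum ctr δ₀ c n y y' ≤ ν * Real.exp (2 * δ₀ * c) * Real.exp (-(δ₀ * dist y y')) * K ^ n := by
  set E : ℝ := Real.exp (2 * δ₀ * c) * Real.exp (-(δ₀ * dist y y')) with hE
  have hE0 : 0 ≤ E := mul_nonneg (Real.exp_pos _).le (Real.exp_pos _).le
  set F : S → ℝ := fun z => if dist y (ctr z) ≤ c then 1 else 0 with hF
  have hF0 : ∀ z, 0 ≤ F z := fun z => by simp only [hF]; split_ifs <;> norm_num
  -- termwise: use the end-point conditions for the decay extraction, then drop the `y′`-condition
  have hterm : ∀ ω : Fin (n + 1) → S,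
      (if dist y (ctr (ω 0)) ≤ c ∧ dist (ctr (ω (Fin.last n))) y' ≤ c then walkWeight ctr (2 * δ₀) n ω else 0)
        ≤ E * (F (ω 0) * walkWeight ctr δ₀ n ω) := by
    intro ω
    by_cases hA : dist y (ctr (ω 0)) ≤ c
    · have hF1 : F (ω 0) = 1 := by simp [hF, hA]
      rw [hF1, one_mul]
      by_cases hB : dist (ctr (ω (Fin.last n))) y' ≤ c
      · rw [if_pos ⟨hA, hB⟩, hE]
        exact walkWeight_split ctr δ₀ c hδ n ω y y' hA hB
      · rw [if_neg (fun h => hB h.2)]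
        exact mul_nonneg hE0 (walkWeight_nonneg ctr δ₀ n ω)
    · have hF1 : F (ω 0) = 0 := by simp [hF, hA]
      rw [if_neg (fun h => hA h.1), hF1, zero_mul, mul_zero]
  have hcard : ∑ z : S, F z = ((Finset.univ.filter fun z : S => dist y (ctr z) ≤ c).card : ℝ) := by
    simp only [hF]
    exact Finset.sum_boole _ _
  calc walkSum ctr δ₀ c n y y'
      ≤ ∑ ω : Fin (n + 1) → S, E * (F (ω 0) * walkWeight ctr δ₀ n ω) := Finset.sum_le_sum fun ω _ => hterm ω
    _ = E * ∑ z : S, F z * tupleSum (fun a b => Real.exp (-(δ₀ * dist (ctr a) (ctr b)))) n z := by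
        rw [← Finset.mul_sum, sum_walkWeight_cons]
    _ ≤ E * ∑ z : S, F z * K ^ n := by
        refine mul_le_mul_of_nonneg_left (Finset.sum_le_sum fun z _ => ?_) hE0
        exact mul_le_mul_of_nonneg_left (tupleSum_le_pow ctr δ₀ K hrow n z) (hF0 z)
    _ = E * K ^ n * ∑ z : S, F z := by rw [← Finset.sum_mul]; ring
    _ ≤ E * K ^ n * ν := by
        rw [hcard] at *
        exact mul_le_mul_of_nonneg_left (hcard ▸ hν) (mul_nonneg hE0 (pow_nonneg hK n))
    _ = ν * Real.exp (2 * δ₀ * c) * Real.exp (-(δ₀ * dist y y')) * K ^ n := by rw [hE]; ring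

/-- **(1.131), the series**: `Σ_{n<N} Θⁿ Σ_{ω} ⋯ ≤ ν e^{2δ₀c} e^{−δ₀|y−y′|} (1 − ΘK)⁻¹`, uniformly in `N`, under the
smallness `ΘK < 1` ("we can fix M₀ depending on d only, such that the series is convergent", p. 39). [cite: Balaban1984PropagatorsI, (1.131) p.38, p.39] -/
theorem walkSeries_le [Fintype S] (ctr : S → X) (δ₀ c K ν Θ : ℝ) (hδ : 0 ≤ δ₀) (hK : 0 ≤ K) (hΘ : 0 ≤ Θ) (hν0 : 0 ≤ ν)
    (hrow : ∀ a : S, ∑ b : S, Real.exp (-(δ₀ * dist (ctr a) (ctr b))) ≤ K) (hsmall : Θ * K < 1)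
    (y y' : X) (hν : ((Finset.univ.filter fun z : S => dist y (ctr z) ≤ c).card : ℝ) ≤ ν) (N : ℕ) :
    ∑ n ∈ Finset.range N, Θ ^ n * walkSum ctr δ₀ c n y y'
      ≤ ν * Real.exp (2 * δ₀ * c) * Real.exp (-(δ₀ * dist y y')) * (1 - Θ * K)⁻¹ := by
  set E : ℝ := ν * Real.exp (2 * δ₀ * c) * Real.exp (-(δ₀ * dist y y')) with hE
  have hE0 : 0 ≤ E := mul_nonneg (mul_nonneg hν0 (Real.exp_pos _).le) (Real.exp_pos _).le
  have hq0 : 0 ≤ Θ * K := mul_nonneg hΘ hK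
  have hgeom : ∑ n ∈ Finset.range N, (Θ * K) ^ n ≤ (1 - Θ * K)⁻¹ :=
    sum_le_hasSum (Finset.range N) (fun n _ => pow_nonneg hq0 n) (hasSum_geometric_of_lt_one hq0 hsmall)
  calc ∑ n ∈ Finset.range N, Θ ^ n * walkSum ctr δ₀ c n y y'
      ≤ ∑ n ∈ Finset.range N, Θ ^ n * (E * K ^ n) := Finset.sum_le_sum fun n _ =>
          mul_le_mul_of_nonneg_left (by rw [hE]; exact walkSum_le ctr δ₀ c K ν hδ hK hrow y y' hν n)
            (pow_nonneg hΘ n)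
    _ = E * ∑ n ∈ Finset.range N, (Θ * K) ^ n := by
        rw [Finset.mul_sum]; refine Finset.sum_congr rfl fun n _ => ?_; rw [mul_pow]; ring
    _ ≤ E * (1 - Θ * K)⁻¹ := mul_le_mul_of_nonneg_left hgeom hE0

/-- **(1.131), the infinite series** (p. 39: "such that the series is convergent"): under `ΘK < 1` the series
`Σ_n Θⁿ Σ_ω ⋯` is summable and its sum obeys the bound of `walkSeries_le`. [cite: Balaban1984PropagatorsI, (1.131) p.38, p.39] -/
theorem walkSeries_summable [Fintype S] (ctr : S → X) (δ₀ c K ν Θ : ℝ) (hδ : 0 ≤ δ₀) (hK : 0 ≤ K) (hΘ : 0 ≤ Θ)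
    (hν0 : 0 ≤ ν) (hrow : ∀ a : S, ∑ b : S, Real.exp (-(δ₀ * dist (ctr a) (ctr b))) ≤ K) (hsmall : Θ * K < 1)
    (y y' : X) (hν : ((Finset.univ.filter fun z : S => dist y (ctr z) ≤ c).card : ℝ) ≤ ν) :
    Summable (fun n => Θ ^ n * walkSum ctr δ₀ c n y y') ∧
      ∑' n, Θ ^ n * walkSum ctr δ₀ c n y y'
        ≤ ν * Real.exp (2 * δ₀ * c) * Real.exp (-(δ₀ * dist y y')) * (1 - Θ * K)⁻¹ := by
  have hnn : ∀ n, 0 ≤ Θ ^ n * walkSum ctr δ₀ c n y y' := fun n =>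
    mul_nonneg (pow_nonneg hΘ n) (Finset.sum_nonneg fun ω _ => by
      split_ifs
      · exact walkWeight_nonneg ctr _ n ω
      · exact le_rfl)
  have hb := walkSeries_le ctr δ₀ c K ν Θ hδ hK hΘ hν0 hrow hsmall y y' hν
  exact ⟨summable_of_sum_range_le hnn hb, Real.tsum_le_of_sum_range_le hnn hb⟩

/-- The choice of `δ₀` (p. 38, before (1.128)): "Defining `2δ₀ = min{⅓δ′₀, M₀⁻¹}`". [cite: Balaban1984PropagatorsI, p.38 before (1.128)] -/
def twoDelta0 (δ₀' M₀ : ℝ) : ℝ := min (δ₀' / 3) M₀⁻¹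

/-- `2δ₀ ≤ M₀⁻¹`. [cite: Balaban1984PropagatorsI, p.38 before (1.128)] -/
theorem twoDelta0_le_inv (δ₀' M₀ : ℝ) : twoDelta0 δ₀' M₀ ≤ M₀⁻¹ := min_le_right _ _

/-- `2δ₀ ≤ ⅓δ′₀`. [cite: Balaban1984PropagatorsI, p.38 before (1.128)] -/
theorem twoDelta0_le_third (δ₀' M₀ : ℝ) : twoDelta0 δ₀' M₀ ≤ δ₀' / 3 := min_le_left _ _

/-- `0 ≤ 2δ₀` for `δ′₀, M₀ ≥ 0`. [cite: Balaban1984PropagatorsI, p.38 before (1.128)] -/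
theorem twoDelta0_nonneg {δ₀' M₀ : ℝ} (h1 : 0 ≤ δ₀') (h2 : 0 ≤ M₀) : 0 ≤ twoDelta0 δ₀' M₀ :=
  le_min (by linarith) (inv_nonneg.mpr h2)

/-- the prefactor `e^{2δ₀c}` of the decay extraction is `O(1)` when `c ≤ c′M₀` (a point of `□_{ω₀}` is within `O(1)·M₀` of its
centre) because `2δ₀ ≤ M₀⁻¹`: `e^{2δ₀ c} ≤ e^{c′}`. [cite: Balaban1984PropagatorsI, p.38] -/
theorem prefactor_le {δ₀' M₀ c c' : ℝ} (hM : 0 < M₀) (hc : 0 ≤ c) (hcc : c ≤ c' * M₀) :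
    Real.exp (twoDelta0 δ₀' M₀ * c) ≤ Real.exp c' := by
  apply Real.exp_le_exp.mpr
  calc twoDelta0 δ₀' M₀ * c ≤ M₀⁻¹ * c := mul_le_mul_of_nonneg_right (twoDelta0_le_inv δ₀' M₀) hc
    _ ≤ M₀⁻¹ * (c' * M₀) := mul_le_mul_of_nonneg_left hcc (inv_nonneg.mpr hM.le)
    _ = c' := by field_simp

/-- in the regime `M₀ ≥ 3/δ′₀` (large cubes) the minimum is `M₀⁻¹`, so `δ₀M₀ = ½` and the printed lattice sum
`Σ_{x∈Z^d} e^{−δ₀M₀|x|} = Σ_x e^{−|x|/2}` is a constant depending on `d` only (p. 39: "the constant O(1) under the sum above is an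
absolute constant depending on d only, hence we can fix M₀ depending on d only, such that the series is convergent"). [cite: Balaban1984PropagatorsI, p.38, p.39] -/
theorem twoDelta0_eq_inv {δ₀' M₀ : ℝ} (hM : 0 < M₀) (hδ : 0 < δ₀') (hlarge : 3 / δ₀' ≤ M₀) :
    twoDelta0 δ₀' M₀ = M₀⁻¹ := by
  unfold twoDelta0
  apply min_eq_right
  rw [inv_eq_one_div, div_le_div_iff₀ hM (by norm_num : (0:ℝ) < 3)]
  have := (div_le_iff₀ hδ).mp hlarge
  linarith

/-- Convergence criterion of the printed series `Σ_n O(1)^{2n} M₀^{−n} K_dⁿ`: ratio `< 1` as soon as `M₀ > O(1)² K_d`. [cite: Balaban1984PropagatorsI, p.39] -/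
theorem ratio_lt_one {C K M₀ : ℝ} (hM : 0 < M₀) (hbig : C ^ 2 * K < M₀) :
    C ^ 2 * M₀⁻¹ * K < 1 := by
  rw [show C ^ 2 * M₀⁻¹ * K = (C ^ 2 * K) / M₀ by ring, div_lt_one hM]
  exact hbig

end

section Hypotheses
/-! ### The two hypotheses of `walkSum_le` left in printed shape, in the `Z^d` model -/

/-- Per coordinate: the integers `m` with `|t − m| ≤ 1` lie in `{⌊t⌋−1, ⌊t⌋, ⌊t⌋+1}`. [cite: Balaban1984PropagatorsI, p.36 (cubes □_z)] [folklore] -/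
theorem int_mem_three_of_abs_sub_le_one (t : ℝ) (m : ℤ) (h : |t - (m : ℝ)| ≤ 1) :
    m ∈ ({⌊t⌋ - 1, ⌊t⌋, ⌊t⌋ + 1} : Finset ℤ) := by
  have h1 : (m : ℝ) ≤ t + 1 := by linarith [abs_le.mp h |>.1]
  have h2 : t - 1 ≤ (m : ℝ) := by linarith [abs_le.mp h |>.2]
  have hm1 : m ≤ ⌊t⌋ + 1 := by
    have : m ≤ ⌊t + 1⌋ := Int.le_floor.mpr h1
    rwa [Int.floor_add_one] at this
  have hm2 : ⌊t⌋ - 1 ≤ m := by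
    have ht : (⌊t⌋ : ℝ) ≤ t := Int.floor_le t
    have : ((⌊t⌋ - 1 : ℤ) : ℝ) ≤ (m : ℝ) := by push_cast; linarith
    exact_mod_cast this
  simp only [Finset.mem_insert, Finset.mem_singleton]
  omega

/-- **ν(d) ≤ 3^d**: a point `y` of `ℝ^d` lies in at most `3^d` of the cubes `□_z = {y : |y_i − M₀ z′_i| ≤ M₀ ∀ i}` (size `2M₀`,
centres `z = M₀z′`, `z′ ∈ Z^d`; p. 36: "cubes □_z of size 2M₀ and with a center at the point z ∈ T^{(k+m₀)}_{M₀}. These cubes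
cover the lattice T_η."): any finite set `T` of such indices has `#T ≤ 3^d` — the hypothesis `ν` of `walkSum_le` in the sup-norm cube
model. [cite: Balaban1984PropagatorsI, p.36 (cubes □_z), (1.131) p.38] -/
theorem card_cubes_containing_le (d : ℕ) {M₀ : ℝ} (hM : 0 < M₀) (y : Fin d → ℝ) (T : Finset (Fin d → ℤ))
    (hT : ∀ z ∈ T, ∀ i, |y i - M₀ * (z i : ℝ)| ≤ M₀) : T.card ≤ 3 ^ d := by
  classical
  set t : Fin d → Finset ℤ := fun i => {⌊y i / M₀⌋ - 1, ⌊y i / M₀⌋, ⌊y i / M₀⌋ + 1} with ht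
  have hsub : T ⊆ Fintype.piFinset t := by
    intro z hz
    rw [Fintype.mem_piFinset]
    intro i
    apply int_mem_three_of_abs_sub_le_one
    have h := hT z hz i
    have : |y i / M₀ - (z i : ℝ)| = |y i - M₀ * (z i : ℝ)| / M₀ := by
      rw [← abs_of_pos hM, ← abs_div, abs_of_pos hM]
      congr 1
      field_simp
    rw [this, div_le_one hM]
    exact h
  calc T.card ≤ (Fintype.piFinset t).card := Finset.card_le_card hsub
    _ = ∏ i, (t i).card := Fintype.card_piFinset t
    _ ≤ 3 ^ (Finset.univ : Finset (Fin d)).card :=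
        Finset.prod_le_pow_card _ _ 3 (fun i _ => Finset.card_le_three)
    _ = 3 ^ d := by simp

/-- **torus row sum ≤ lattice series**: if every site `b` of the finite set `S` is assigned injectively a lattice vector
`r b` (its minimal representative relative to `a`) with `f b ≤ g (r b)`, and `g ≥ 0` is summable on the lattice, then
`Σ_{b∈S} f b ≤ Σ'_{x} g x` — the printed `Σ_{z′} e^{−δ₀|z−z′|} ≤ Σ_{x∈Z^d} e^{−δ₀M₀|x|}` (each torus site counted once, at its torus
distance). [cite: Balaban1984PropagatorsI, (1.131) p.38] [folklore] -/
theorem sum_le_tsum_of_injective {S ι : Type} [Fintype S] [DecidableEq ι] (g : ι → ℝ) (hg0 : ∀ i, 0 ≤ g i)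
    (hg : Summable g) (r : S → ι) (hr : Function.Injective r) (f : S → ℝ) (hf : ∀ b, f b ≤ g (r b)) :
    ∑ b, f b ≤ ∑' i, g i := by
  calc ∑ b, f b ≤ ∑ b, g (r b) := Finset.sum_le_sum fun b _ => hf b
    _ = ∑ i ∈ Finset.univ.image r, g i := by
        rw [Finset.sum_image (fun a _ b _ h => hr h)]
    _ ≤ ∑' i, g i := hg.sum_le_tsum _ (fun i _ => hg0 i)


/-- The row-sum hypothesis `hrow` of `walkSum_le` from the lattice series: if for every centre `a` the other centres `b` have
injective lattice representatives `rep a b` with `e^{−δ₀|a−b|} ≤ g (rep a b)`, `g ≥ 0` summable (printed: `g x = e^{−δ₀M₀|x|}` on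
`Z^d`), then `Σ_b e^{−δ₀|a−b|} ≤ Σ'_x g x` for every `a`. [cite: Balaban1984PropagatorsI, (1.131) p.38] -/
theorem row_sum_le_lattice {X S ι : Type} [PseudoMetricSpace X] [Fintype S] [DecidableEq ι] (ctr : S → X) (δ₀ : ℝ)
    (g : ι → ℝ) (hg0 : ∀ i, 0 ≤ g i) (hg : Summable g) (rep : S → S → ι) (hinj : ∀ a, Function.Injective (rep a))
    (hle : ∀ a b, Real.exp (-(δ₀ * dist (ctr a) (ctr b))) ≤ g (rep a b)) (a : S) :
    ∑ b : S, Real.exp (-(δ₀ * dist (ctr a) (ctr b))) ≤ ∑' i, g i :=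
  sum_le_tsum_of_injective g hg0 hg (rep a) (hinj a) _ (hle a)

end Hypotheses

end Literature.MathematicalPhysics.QuantumFieldTheory.Balaban1983to89.B5Walk131
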